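import Summits.KontsevichZagierPeriods.KontsevichZagierPeriods.Theorems.BetaCancellation.Negative.PiLinkReps
import Literature.NumberTheory.Transcendental.KZSemialgebraicComplex
import Literature.NumberTheory.Transcendental.KZLogCalculusProofs

/-!
# `BetaCancellation` (stmt-KontsevichZagierPeriods-13633) — line `dirichlet-companion-to-pi`,
stub `stub_moebiusMove`

Step 4 of the one-dimensional proof of Euler reflection inside the Kontsevich–Zagier calculus
(item stmt-KontsevichZagierPeriods-3383): after partial fractions every term lives on an interval of
the `t`-line with the integrand `κ/(1+t²)`, and the Möbius maps `M(t) = (c·t − s)/(s·t + c)` with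
`(c, s) = (cos α, sin α)` REAL ALGEBRAIC, `c² + s² = 1`, act on the `t`-line as rotations by `−α` of
the circle `t = tan(angle)`; they PRESERVE `dt/(1+t²)`. This file realises one such rotation as ONE
change-of-variables move (rule (2) of the calculus, `KZ.changeOfVariablesRel`): on an interval
`(u, v)` on whose closure the denominator `s·t + c` is positive,

* `M'(t) = (c(st+c) − (ct−s)s)/(st+c)² = (c²+s²)/(st+c)² = 1/(st+c)²` (`moeb_hasDerivAt`), so `M` is
  strictly increasing (`moeb_lt`), injective, and maps `(u, v)` onto `(M u, M v)` (intermediate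
  values, `moeb_image`);
* `1 + M(t)² = ((st+c)² + (ct−s)²)/(st+c)² = (1+t²)/(st+c)²` (`moeb_one_add_sq`), whence the
  pull-back identity `κ/(1+M(t)²) · |M'(t)| = κ/(1+t²)` (`moeb_pullback`);
* the self-map `Φ(x) = (M(x₀))` of `ℝ¹` has derivative `M'(x₀) • id`, `|det| = 1/(s x₀ + c)²`
  (`moeb_hasFDerivAt`, `moeb_abs_det`), and is a `ℚ`-semialgebraic map (`moeb_isSemialgebraicMapOn`:
  the coefficients `c, s` are algebraic irrationals in general, so `Φ` is NOT a `ℚ`-polynomial map;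
  constants with real-algebraic values are `ℚ`-semialgebraic functions,
  `isSemialgebraicFunOn_const_of_isAlgebraic`, and the class is closed under `+, −, *, /`).

Hence for the GIVEN representations `T = [(u,v), κ/(1+t²)]`, `T' = [(M u, M v), κ/(1+t²)]` one has
`[T] − [T'] ∈ changeOfVariablesRel`, so `KZ.Equivalent T T'` (`stub_moebiusMove`). No definitions are
introduced (the chart and its derivative are written out): a pure proof file. Pattern of
`…/BetaCancellation/Negative/PiLinkReps.lean` (move 1) and
`TerasomaMultiplicationBetaCancellationStubDirichletLinear.lean`.

References: M. Kontsevich, D. Zagier, *Periods* (2001), §1.2 rule (2).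
-/

noncomputable section

-- `Summit.KontsevichZagierPeriods.KontsevichZagierPeriods.…` is the tree's mandated layout (single-conjunct summit).
set_option linter.dupNamespace false

namespace Summit.KontsevichZagierPeriods.KontsevichZagierPeriods.BetaCancellationLine

open MeasureTheory Set
open Literature.NumberTheory.Transcendental
open Literature.NumberTheory.Transcendental.KZ
open Literature.ModelTheory.ExponentialFields (IsSemialgebraic)
open MvPolynomial (aeval X C)

/-! ## Algebra of the rotation `M(t) = (ct − s)/(st + c)`, `c² + s² = 1` -/

/-- The cross-difference identity `(c b − s)(s a + c) − (c a − s)(s b + c) = b − a` for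
`c² + s² = 1` (it drives monotonicity and injectivity of `M`). [folklore] -/
theorem moeb_cross_sub {c s : ℝ} (hcs : c ^ 2 + s ^ 2 = 1) (a b : ℝ) :
    (c * b - s) * (s * a + c) - (c * a - s) * (s * b + c) = b - a := by
  linear_combination (b - a) * hcs

/-- `M` is strictly increasing where its denominator is positive. [folklore] -/
theorem moeb_lt {c s : ℝ} (hcs : c ^ 2 + s ^ 2 = 1) {a b : ℝ} (ha : 0 < s * a + c)
    (hb : 0 < s * b + c) (hab : a < b) :
    (c * a - s) / (s * a + c) < (c * b - s) / (s * b + c) := by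
  rw [div_lt_div_iff₀ ha hb]
  linarith [moeb_cross_sub hcs a b]

/-- `1 + M(t)² = (1 + t²)/(st + c)²` for `c² + s² = 1`. [folklore] -/
theorem moeb_one_add_sq {c s : ℝ} (hcs : c ^ 2 + s ^ 2 = 1) {t : ℝ} (ht : s * t + c ≠ 0) :
    1 + ((c * t - s) / (s * t + c)) ^ 2 = (1 + t ^ 2) / (s * t + c) ^ 2 := by
  rw [div_pow, eq_div_iff (pow_ne_zero 2 ht), add_mul, one_mul,
    div_mul_cancel₀ _ (pow_ne_zero 2 ht)]
  linear_combination (t ^ 2 + 1) * hcs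

/-- **The pull-back identity** of the move: `κ/(1 + M(t)²) · (1/(st+c)²) = κ/(1+t²)`. [folklore] -/
theorem moeb_pullback {c s : ℝ} (hcs : c ^ 2 + s ^ 2 = 1) (κ : ℝ) {t : ℝ} (ht : s * t + c ≠ 0) :
    κ / (1 + ((c * t - s) / (s * t + c)) ^ 2) * (1 / (s * t + c) ^ 2) = κ / (1 + t ^ 2) := by
  rw [moeb_one_add_sq hcs ht, div_div_eq_mul_div, mul_one_div, div_right_comm,
    mul_div_cancel_right₀ κ (pow_ne_zero 2 ht)]

/-- `M` has derivative `M'(t) = 1/(st+c)²` off the pole (quotient rule; the numerator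
`c(st+c) − (ct−s)s` is `c² + s² = 1`). [folklore] -/
theorem moeb_hasDerivAt {c s : ℝ} (hcs : c ^ 2 + s ^ 2 = 1) {t : ℝ} (ht : s * t + c ≠ 0) :
    HasDerivAt (fun y : ℝ => (c * y - s) / (s * y + c)) (1 / (s * t + c) ^ 2) t := by
  have h1 : HasDerivAt (fun y : ℝ => c * y - s) c t := (hasDerivAt_const_mul c).sub_const s
  have h2 : HasDerivAt (fun y : ℝ => s * y + c) s t := (hasDerivAt_const_mul s).add_const c
  refine (h1.fun_div h2 ht).congr_deriv ?_
  congr 1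
  linear_combination hcs

/-- `M` is continuous on `[u, v]` when its denominator is positive there. [folklore] -/
theorem moeb_continuousOn {c s u v : ℝ} (hpos : ∀ t ∈ Icc u v, 0 < s * t + c) :
    ContinuousOn (fun y : ℝ => (c * y - s) / (s * y + c)) (Icc u v) :=
  ContinuousOn.div (by fun_prop) (by fun_prop) fun t ht => (hpos t ht).ne'

/-! ## The chart `Φ(x) = (M(x₀))` of `ℝ¹` -/

/-- `Φ` has derivative `M'(x₀) • id` off the pole (chain rule through the coordinate `x₀`).
[folklore] -/
theorem moeb_hasFDerivAt {c s : ℝ} (hcs : c ^ 2 + s ^ 2 = 1) {x : Fin 1 → ℝ}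
    (hx : s * x 0 + c ≠ 0) :
    HasFDerivAt (fun y : Fin 1 → ℝ => fun _ : Fin 1 => (c * y 0 - s) / (s * y 0 + c))
      ((1 / (s * x 0 + c) ^ 2) • ContinuousLinearMap.id ℝ (Fin 1 → ℝ)) x := by
  rw [hasFDerivAt_pi']
  intro i
  obtain rfl : i = 0 := Fin.fin_one_eq_zero i
  have h0 : HasFDerivAt (fun f : Fin 1 → ℝ => f 0)
      (ContinuousLinearMap.proj (R := ℝ) (φ := fun _ : Fin 1 => ℝ) 0) x :=
    hasFDerivAt_apply 0 x
  refine ((moeb_hasDerivAt hcs hx).comp_hasFDerivAt x h0).congr_fderiv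
    (ContinuousLinearMap.ext fun v => ?_)
  simp

/-- `|det (a • id_{ℝ¹})| = a` for `0 < a`. [folklore] -/
theorem moeb_abs_det {a : ℝ} (ha : 0 < a) :
    |(a • ContinuousLinearMap.id ℝ (Fin 1 → ℝ)).det| = a := by
  have : (a • ContinuousLinearMap.id ℝ (Fin 1 → ℝ)).det = a := by
    change LinearMap.det (((a • ContinuousLinearMap.id ℝ (Fin 1 → ℝ) :
      (Fin 1 → ℝ) →L[ℝ] (Fin 1 → ℝ))) : (Fin 1 → ℝ) →ₗ[ℝ] (Fin 1 → ℝ)) = a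
    rw [ContinuousLinearMap.toLinearMap_smul, ContinuousLinearMap.coe_id, LinearMap.det_smul,
      LinearMap.det_id, Module.finrank_fin_fun]
    simp
  rw [this, abs_of_pos ha]

/-- `Φ` is injective where the denominator is positive (cross-multiply and use the
cross-difference identity). [folklore] -/
theorem moeb_injOn {c s : ℝ} (hcs : c ^ 2 + s ^ 2 = 1) {σ : Set (Fin 1 → ℝ)}
    (hden : ∀ x ∈ σ, 0 < s * x 0 + c) :
    InjOn (fun y : Fin 1 → ℝ => fun _ : Fin 1 => (c * y 0 - s) / (s * y 0 + c)) σ := by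
  intro x hx y hy hxy
  have h0 : (c * x 0 - s) / (s * x 0 + c) = (c * y 0 - s) / (s * y 0 + c) := congrFun hxy 0
  rw [div_eq_div_iff (hden x hx).ne' (hden y hy).ne'] at h0
  funext i
  obtain rfl : i = 0 := Fin.fin_one_eq_zero i
  linear_combination h0 - (x 0 - y 0) * hcs

/-- `Φ` maps `(u, v)` ONTO `(M u, M v)`: into by strict monotonicity, onto by the intermediate
value theorem on `[u, v]`. [folklore] -/
theorem moeb_image {c s : ℝ} (hcs : c ^ 2 + s ^ 2 = 1) {u v : ℝ} (huv : u < v)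
    (hpos : ∀ t ∈ Icc u v, 0 < s * t + c) :
    (fun y : Fin 1 → ℝ => fun _ : Fin 1 => (c * y 0 - s) / (s * y 0 + c)) '' {x | x 0 ∈ Ioo u v} =
      {x | x 0 ∈ Ioo ((c * u - s) / (s * u + c)) ((c * v - s) / (s * v + c))} := by
  ext y
  constructor
  · rintro ⟨x, hx, rfl⟩
    have hx' : x 0 ∈ Ioo u v := hx
    have hxI : x 0 ∈ Icc u v := Ioo_subset_Icc_self hx'
    exact ⟨moeb_lt hcs (hpos u (left_mem_Icc.2 huv.le)) (hpos _ hxI) hx'.1,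
      moeb_lt hcs (hpos _ hxI) (hpos v (right_mem_Icc.2 huv.le)) hx'.2⟩
  · intro hy
    have hy' : y 0 ∈ Ioo ((c * u - s) / (s * u + c)) ((c * v - s) / (s * v + c)) := hy
    obtain ⟨t, ht, hty⟩ := intermediate_value_Ioo huv.le (moeb_continuousOn hpos) hy'
    refine ⟨fun _ => t, ht, ?_⟩
    funext i
    obtain rfl : i = 0 := Fin.fin_one_eq_zero i
    exact hty

/-- `Φ` is a `ℚ`-semialgebraic map on any `ℚ`-semialgebraic set off the pole: `c, s` are real
algebraic, so the constants `c`, `s` are `ℚ`-semialgebraic functions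
(`isSemialgebraicFunOn_const_of_isAlgebraic`), and the class is closed under `+, −, *, /`.
[folklore] -/
theorem moeb_isSemialgebraicMapOn {c s : ℝ} (hc : IsAlgebraic ℚ c) (hs : IsAlgebraic ℚ s)
    {σ : Set (Fin 1 → ℝ)} (hσ : IsSemialgebraic ℚ σ) (h0 : ∀ x ∈ σ, s * x 0 + c ≠ 0) :
    IsSemialgebraicMapOn ℚ σ
      (fun y : Fin 1 → ℝ => fun _ : Fin 1 => (c * y 0 - s) / (s * y 0 + c)) := by
  have hc' : IsSemialgebraicFunOn ℚ σ (fun _ => c) := isSemialgebraicFunOn_const_of_isAlgebraic hσ hc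
  have hs' : IsSemialgebraicFunOn ℚ σ (fun _ => s) := isSemialgebraicFunOn_const_of_isAlgebraic hσ hs
  have hx : IsSemialgebraicFunOn ℚ σ (fun x => x 0) :=
    (isSemialgebraicFunOn_aeval hσ (X 0)).congr fun x _ => by simp
  have hnum : IsSemialgebraicFunOn ℚ σ (fun x => c * x 0 - s) :=
    (IsSemialgebraicFunOn.sub_holds (IsSemialgebraicFunOn.mul_holds hc' hx) hs').congr
      fun x _ => rfl
  have hden : IsSemialgebraicFunOn ℚ σ (fun x => s * x 0 + c) :=
    (IsSemialgebraicFunOn.add_holds (IsSemialgebraicFunOn.mul_holds hs' hx) hc').congr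
      fun x _ => rfl
  exact IsSemialgebraicMapOn.of_forall hσ fun _ => hnum.div hden h0

/-! ## The stub -/

/-- **Registered stub `stub_moebiusMove`** (line `dirichlet-companion-to-pi` of crux
stmt-KontsevichZagierPeriods-13633, step 4 of Euler reflection inside the calculus): the Möbius
rotation `t ↦ (ct − s)/(st + c)` (`c² + s² = 1`, `c, s` real algebraic) is ONE rule-(2) move
preserving the integrand `κ/(1+t²)` on any interval `(u, v)` with `st + c > 0` on `[u, v]`:
`[(u,v), κ/(1+t²)] ∼ [(M u, M v), κ/(1+t²)]` for any two representations `T`, `T'` with these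
domains and integrands (`[T] − [T'] ∈ changeOfVariablesRel`, source first). The hypothesis
`IsAlgebraic ℚ κ` is not used: both representations are given. [cite: KontsevichZagier2001, §1.2] -/
theorem stub_moebiusMove : ∀ (c s κ : ℝ), IsAlgebraic ℚ c → IsAlgebraic ℚ s → IsAlgebraic ℚ κ →
    c ^ 2 + s ^ 2 = 1 → ∀ (u v : ℝ), u < v → (∀ t ∈ Set.Icc u v, 0 < s * t + c) →
    ∀ (T T' : Literature.NumberTheory.Transcendental.KZ.IntegralRep 1),
    T.domain = {x | x 0 ∈ Set.Ioo u v} →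
    Set.EqOn T.integrand (fun x => κ / (1 + (x 0) ^ 2)) T.domain →
    T'.domain = {x | x 0 ∈ Set.Ioo ((c * u - s) / (s * u + c)) ((c * v - s) / (s * v + c))} →
    Set.EqOn T'.integrand (fun x => κ / (1 + (x 0) ^ 2)) T'.domain →
    Literature.NumberTheory.Transcendental.KZ.Equivalent T T' := by
  intro c s κ hc hs _ hcs u v huv hpos T T' hTd hTi hT'd hT'i
  -- the denominator is positive on `T.domain ⊆ [u, v]`
  have hden : ∀ x ∈ T.domain, 0 < s * x 0 + c := fun x hx =>
    hpos (x 0) (Ioo_subset_Icc_self (by rw [hTd] at hx; exact hx))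
  -- the chart maps `T.domain` onto `T'.domain`
  have himage : T'.domain =
      (fun y : Fin 1 → ℝ => fun _ : Fin 1 => (c * y 0 - s) / (s * y 0 + c)) '' T.domain := by
    rw [hTd, moeb_image hcs huv hpos, hT'd]
  refine changeOfVariablesRel_subset_relations
    ⟨1, T, T', fun y : Fin 1 → ℝ => fun _ : Fin 1 => (c * y 0 - s) / (s * y 0 + c),
      fun x => (1 / (s * x 0 + c) ^ 2) • ContinuousLinearMap.id ℝ (Fin 1 → ℝ),
      moeb_isSemialgebraicMapOn hc hs T.isSemialgebraic_domain fun x hx => (hden x hx).ne',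
      fun x hx => (moeb_hasFDerivAt hcs (hden x hx).ne').hasFDerivWithinAt,
      moeb_injOn hcs hden, himage, fun x hx => ?_, rfl⟩
  -- the pull-back identity on `T.domain`, Jacobian `|det Φ'| = 1/(s x₀ + c)²` included
  have hΦx : (fun y : Fin 1 → ℝ => fun _ : Fin 1 => (c * y 0 - s) / (s * y 0 + c)) x ∈ T'.domain :=
    himage ▸ mem_image_of_mem _ hx
  have e1 : T.integrand x = κ / (1 + x 0 ^ 2) := hTi hx
  have e2 : T'.integrand (fun _ : Fin 1 => (c * x 0 - s) / (s * x 0 + c)) =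
      κ / (1 + ((c * x 0 - s) / (s * x 0 + c)) ^ 2) := hT'i hΦx
  have e3 : |((1 / (s * x 0 + c) ^ 2) • ContinuousLinearMap.id ℝ (Fin 1 → ℝ)).det| =
      1 / (s * x 0 + c) ^ 2 := moeb_abs_det (one_div_pos.2 (pow_pos (hden x hx) 2))
  show T.integrand x = T'.integrand (fun _ : Fin 1 => (c * x 0 - s) / (s * x 0 + c)) *
    |((1 / (s * x 0 + c) ^ 2) • ContinuousLinearMap.id ℝ (Fin 1 → ℝ)).det|
  rw [e1, e2, e3]
  exact (moeb_pullback hcs κ (hden x hx).ne').symm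

end Summit.KontsevichZagierPeriods.KontsevichZagierPeriods.BetaCancellationLine
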